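import Literature.AlgebraicGeometry.HodgeTheory.PuncturedVarietyHomology
import Literature.AlgebraicGeometry.HodgeTheory.CycleClassPushforward
import Literature.AlgebraicGeometry.Resolution.Lemma411OffVertex
import Literature.AlgebraicGeometry.Motives.ProjectiveSpaceCoordinateEmbedding
import Literature.AlgebraicGeometry.Motives.FiniteFlatDegreeProofs
import Literature.AlgebraicGeometry.Motives.PlaneFamilyRelation
import Literature.Topology.FourManifolds.SigPosOfNonzeroRealClass
import HarnessLib

/-!
# Projection from the vertex: `H_{2d}((ℙ^{d+1} ∖ vertex)(ℂ)) → H_{2d}(ℙ^d(ℂ))` is one-to-one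

Family `hodge`, layer `Literature/AlgebraicGeometry/HodgeTheory`. Topological input for the proof of
Voisin's Lemma 9.18 ("`[div φ] = 0`") on `ℙ^{d+1}` from Fulton's degree formula for the complex
orientations (`OrientationFamily.HasDegreeFormula`, Lemma 19.1.2): the linear projection from the
vertex `pr : ℙ^{d+1} ∖ {vertex} → ℙ^d` (de Jong 1996, proof of Lemma 4.11; the tree's
`DeJong1996.vertexProjection`, here over `ℂ` as `vertexProjectionOver`) induces a ONE-TO-ONE map
`pr(ℂ)_* : H_{2d}((ℙ^{d+1} ∖ vertex)(ℂ); ℂ) → H_{2d}(ℙ^d(ℂ); ℂ)`.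

* `singularHomology_map_fundamentalClass_eq_smul` — **the degree formula in homology**: for a morphism
  `χ : V ⟶ W` of smooth projective `d`-folds of positive degree `k = [κ(η_V) : κ(χ η_V)]`,
  `χ(ℂ)_*[V(ℂ)] = k • [W(ℂ)]` (`HasDegreeFormula` with `τ = 𝟙`, `(𝟙)_* = 𝟙`, `f_* 1 ⌢ [W] = f(ℂ)_*[V]`);
* `puncturedOver d`, `vertexProjectionOver d` — `ℙ^{d+1} ∖ {vertex}` and `pr` over `ℂ`
  (definitions: the tree's open subscheme / projection packaged in `SchemeOver ℂ`);
  `liftOpenSubschemeOver` — lifting a morphism over `ℂ` into an open subscheme;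
* `finrank_singularHomology_puncturedOver` — `H_{2d}((ℙ^{d+1} ∖ vertex)(ℂ); ℂ)` is a line
  (`HodgeTheory/PuncturedVarietyHomology`);
* `injective_singularHomology_map_vertexProjectionOver` — **`pr(ℂ)_*` is one-to-one in degree `2d`**:
  the coordinate hyperplane `V₊(x_{d+1}) ≅ ℙ^d` (`ProjectiveSpace.skipMap`) misses the vertex, the
  composite `ℙ^d → ℙ^{d+1} ∖ {vertex} → ℙ^d` is finite (`DeJong1996.isFinite_comp_vertexProjection`:
  proper and affine), hence of positive degree, so its class maps to a non-zero multiple of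
  `[ℙ^d(ℂ)] ≠ 0`; a linear map out of a line with a non-zero value is one-to-one.

Everything is proved; the only definitions are the three packagings over `ℂ` and the witness
`hyperplaneToPunctured₀`/`hyperplaneToPunctured`; the degree formula enters as the hypothesis
`(hA : complexOrientationFamily.HasDegreeFormula)`.

## References

* [Fulton1998] W. Fulton, Intersection Theory, 2nd ed., Springer 1998, Lemma 19.1.2.
* [FultonYoungTableaux1997] W. Fulton, Young Tableaux, CUP 1997, Appendix B §B.1 (5).
* [DeJong1996] A. J. de Jong, Smoothness, semi-stability and alterations, Publ. Math. IHÉS 83 (1996),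
  proof of Lemma 4.11.
* [GortzWedhorn2020] U. Görtz, T. Wedhorn, Algebraic Geometry I, 2nd ed. 2020, Thm. 13.89 (proof).
* [Hartshorne1977] R. Hartshorne, Algebraic Geometry, GTM 52, II Thm. 7.1, II Ex. 3.12.
* [HatcherAT2002] A. Hatcher, Algebraic Topology, CUP 2002, §3.3 Thm. 3.26, Lemma 3.27.
-/

noncomputable section

open CategoryTheory AlgebraicGeometry Order
open Literature.AlgebraicTopology.SingularHomology
open Literature.AlgebraicGeometry.Motives Literature.AlgebraicGeometry.Resolution

attribute [local instance] MvPolynomial.gradedAlgebra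

namespace Literature.AlgebraicGeometry.HodgeTheory

section HodgeTheory

/-! ### Functoriality of `X ↦ H_k(X(ℂ); ℂ)` on morphisms over `ℂ` -/

/-- `(φ ≫ ψ)(ℂ)_* = ψ(ℂ)_* ∘ φ(ℂ)_*` on `H_k(-(ℂ); ℂ)`, pointwise. [folklore] -/
theorem singularHomology_map_comp_apply {X Y Z : Motives.SchemeOver ℂ} (φ : X ⟶ Y) (ψ : Y ⟶ Z)
    (k : ℕ) (x : singularHomology ℂ ℂ (Motives.ComplexPoints X) k) :
    singularHomology.map ℂ ℂ (AlgPoints.mapContinuous (L := ℂ) (φ ≫ ψ)) k x =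
      singularHomology.map ℂ ℂ (AlgPoints.mapContinuous (L := ℂ) ψ) k
        (singularHomology.map ℂ ℂ (AlgPoints.mapContinuous (L := ℂ) φ) k x) := by
  rw [AlgPoints.mapContinuous_comp, singularHomology.map_comp, ModuleCat.comp_apply]

/-! ### The degree formula in homology: `χ(ℂ)_*[V(ℂ)] = deg χ • [W(ℂ)]` -/

variable {d : ℕ} {V W : Motives.SchemeOver ℂ}

/-- **`χ(ℂ)_* [V(ℂ)] = deg(χ) • [W(ℂ)]`** for a morphism `χ : V ⟶ W` of smooth projective
`d`-folds of positive degree `deg χ = [κ(η_V) : κ(χ η_V)]` (Mathlib's push-forward coefficient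
`AlgebraicCycle.mapCoeff` at the generic point `η_V`), granted Fulton's degree formula
`χ_* 1 = deg(χ) • 1` for the complex orientations (`HasDegreeFormula` with `τ = 𝟙`, then
`(𝟙)_* = 𝟙` and `f_* 1 ⌢ [W(ℂ)] = f(ℂ)_*[V(ℂ)]`). [cite: Fulton1998, Lemma 19.1.2]
[cite: FultonYoungTableaux1997, Appendix B §B.1 (5)] -/
theorem singularHomology_map_fundamentalClass_eq_smul
    (hA : complexOrientationFamily.HasDegreeFormula) (hV : Motives.IsSmoothProjective d V)
    (hW : Motives.IsSmoothProjective d W) (χ : V ⟶ W) {η : V.left} (hη : IsGenericPoint η Set.univ)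
    (hk : 0 < AlgebraicCycle.mapCoeff χ.left height height η) :
    singularHomology.map ℂ ℂ (AlgPoints.mapContinuous (L := ℂ) χ) (2 * d)
        (complexOrientationFamily hV).fundamentalClass =
      (AlgebraicCycle.mapCoeff χ.left height height η : ℂ) •
        (complexOrientationFamily hW).fundamentalClass := by
  classical
  haveI : QuasiCompact χ.left :=
    haveI := isProper_left_of_isSmoothProjective hV hW χ
    inferInstance
  haveI : QuasiCompact (𝟙 W : W ⟶ W).left := by
    rw [Over.id_left]
    infer_instance
  haveI := irreducibleSpace_of_isSmoothProjective' hW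
  haveI : IsIntegral W.left := Motives.IsSmoothProjective.isIntegral_holds hW
  set k := AlgebraicCycle.mapCoeff χ.left height height η with hkdef
  -- `χ η` is the generic point of `W`: the dimension is preserved since the coefficient is non-zero
  have hηd : height η = d := height_eq_of_isGenericPoint hV hη
  have hheight : height η = height (χ.left.base η) := by
    by_contra h
    apply hk.ne'
    rw [hkdef, AlgebraicCycle.mapCoeff, if_neg h]
  have hω : χ.left.base η = genericPoint W.left :=
    eq_genericPoint_of_height_eq (height_eq_of_isGenericPoint hW (genericPoint_spec W.left))
      (hheight ▸ hηd)
  have hmap : AlgebraicCycle.map χ.left height height (Motives.primeCycle η) =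
      k • Motives.primeCycle (genericPoint W.left) := by
    rw [Motives.algebraicCycleMap_primeCycle_eq_nsmul, hω]
  have hid : AlgebraicCycle.map (𝟙 W : W ⟶ W).left height height
      (Motives.primeCycle (genericPoint W.left)) = Motives.primeCycle (genericPoint W.left) := by
    rw [Motives.algebraicCycleMap_congr (Over.id_left W) (Motives.primeCycle (genericPoint W.left)),
      AlgebraicCycle.map_id]
  -- the degree formula with `τ = 𝟙 W`
  have hgysin := hA hW hV hW (Nat.add_zero d) χ (𝟙 W) hη (genericPoint_spec W.left) hk hmap hid
  have hPD := hasPoincareDuality_complexOrientationFamily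
  have h := congrArg (fun y ↦ capProduct (show 2 * 0 + 2 * d = 2 * d by omega) y
    (complexOrientationFamily hW).fundamentalClass) hgysin
  rw [capProduct_complexGysin_one hPD hV hW χ (Nat.add_zero d), LinearMap.map_smul,
    LinearMap.smul_apply, capProduct_complexGysin_one hPD hW hW (𝟙 W) (Nat.add_zero d),
    AlgPoints.mapContinuous_id, singularHomology.map_id, ModuleCat.id_apply] at h
  exact h

/-- **`[X(ℂ)] ≠ 0`** for `X` smooth projective: the fundamental class of the closed non-empty oriented
manifold `X(ℂ)` is non-zero. [cite: HatcherAT2002, §3.3 Thm. 3.26(a)] -/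
theorem fundamentalClass_complexOrientationFamily_ne_zero {n : ℕ} {X : Motives.SchemeOver ℂ}
    (hX : Motives.IsSmoothProjective n X) : (complexOrientationFamily hX).fundamentalClass ≠ 0 := by
  letI := hX.chartedSpace
  haveI := ComplexPoints.t2Space_of_isSmoothProjective hX
  haveI : IsProper X.hom := IsSmoothProjective.isProper_holds hX
  haveI : CompactSpace (ComplexPoints X) := compactSpace_algPoints_of_isProper_holds X ℂ
  haveI := connectedSpace_complexPoints hX
  exact Literature.Topology.FourManifolds.fundamentalClass_ne_zero_of_nontrivial _

/-! ### Lifting a morphism into an open subscheme, over `ℂ` -/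

/-- A morphism `g : V ⟶ X` over `ℂ` whose image lies in the open `O ⊆ X` lifts to `V ⟶ O` over `ℂ`
(`IsOpenImmersion.lift` along `O ↪ X`). [folklore] -/
def liftOpenSubschemeOver {X V : Motives.SchemeOver ℂ} (O : X.left.Opens) (g : V ⟶ X)
    (hg : ∀ v, g.left.base v ∈ O) : V ⟶ Motives.openSubschemeOver X O :=
  haveI : IsOpenImmersion (Motives.openSubschemeOverι X O).left := inferInstanceAs (IsOpenImmersion O.ι)
  Over.homMk (IsOpenImmersion.lift (Motives.openSubschemeOverι X O).left g.left (by
      rintro _ ⟨v, rfl⟩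
      exact ⟨⟨g.left.base v, hg v⟩, rfl⟩)) (by
    rw [← Over.w (Motives.openSubschemeOverι X O), IsOpenImmersion.lift_fac_assoc]
    exact Over.w g)

/-- The lift followed by the open immersion is `g`. [folklore] -/
@[reassoc (attr := simp)]
theorem liftOpenSubschemeOver_ι {X V : Motives.SchemeOver ℂ} (O : X.left.Opens) (g : V ⟶ X)
    (hg : ∀ v, g.left.base v ∈ O) :
    liftOpenSubschemeOver O g hg ≫ Motives.openSubschemeOverι X O = g := by
  haveI : IsOpenImmersion (Motives.openSubschemeOverι X O).left := inferInstanceAs (IsOpenImmersion O.ι)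
  ext : 1
  exact IsOpenImmersion.lift_fac _ _ _

/-! ### The punctured projective space and the projection from the vertex, over `ℂ` -/

variable (d)

/-- **`ℙ^{d+1}_ℂ ∖ {vertex}`** as a scheme over `ℂ` (the open `DeJong1996.puncturedSpace`, the
complement of the vertex `(0 : … : 0 : 1)`). [folklore] -/
def puncturedOver : Motives.SchemeOver ℂ :=
  Motives.openSubschemeOver (projectiveSpace (d + 1) ℂ) (DeJong1996.puncturedSpace d ℂ)

/-- The open immersion `ℙ^{d+1} ∖ {vertex} ↪ ℙ^{d+1}` over `ℂ`. [folklore] -/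
abbrev puncturedOverι : puncturedOver d ⟶ projectiveSpace (d + 1) ℂ :=
  Motives.openSubschemeOverι (projectiveSpace (d + 1) ℂ) (DeJong1996.puncturedSpace d ℂ)

/-- The projection from the vertex is compatible with the structure morphisms to `Spec ℂ`.
[folklore] -/
theorem vertexProjection_comp_hom :
    DeJong1996.vertexProjection d ℂ ≫ (projectiveSpace d ℂ).hom = (puncturedOver d).hom := by
  change _ = (DeJong1996.puncturedSpace d ℂ).ι ≫ (projectiveSpace (d + 1) ℂ).hom
  rw [projectiveSpace_hom_eq_toSpec, projectiveSpace_hom_eq_toSpec]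
  exact DeJong1996.vertexProjection_toSpec d ℂ

/-- **The linear projection from the vertex `pr : ℙ^{d+1} ∖ {vertex} → ℙ^d` over `ℂ`**,
`(x₀ : … : x_{d+1}) ↦ (x₀ : … : x_d)` (`DeJong1996.vertexProjection`, Hartshorne II Thm. 7.1).
[cite: Hartshorne1977, II Thm. 7.1] -/
def vertexProjectionOver : puncturedOver d ⟶ projectiveSpace d ℂ :=
  Over.homMk (DeJong1996.vertexProjection d ℂ) (vertexProjection_comp_hom d)

/-- The underlying morphism of `vertexProjectionOver` (`rfl`). [folklore] -/
theorem vertexProjectionOver_left : (vertexProjectionOver d).left = DeJong1996.vertexProjection d ℂ :=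
  rfl

/-- `H_{2d}((ℙ^{d+1} ∖ vertex)(ℂ); ℂ)` is a line (`Hₖ` of a smooth projective variety punctured at a
point agrees with `Hₖ` of the variety below the top two degrees, and `H_{2d}(ℙ^{d+1}(ℂ); ℂ) ≅ ℂ`).
[cite: HatcherAT2002, §3.3 Lemma 3.27 and Thm. 3.26] -/
theorem finrank_singularHomology_puncturedOver :
    Module.finrank ℂ (singularHomology ℂ ℂ (ComplexPoints (puncturedOver d)) (2 * d)) = 1 :=
  finrank_singularHomology_puncturedProjectiveSpace_eq_one (d + 1)
    (DeJong1996.isClosed_singleton_vertex d ℂ) (DeJong1996.puncturedSpace d ℂ)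
    (DeJong1996.coe_puncturedSpace d ℂ) (p := d) le_rfl

/-! ### The coordinate hyperplane `x_{d+1} = 0` as a witness: `pr_*` is one-to-one -/

/-- The coordinate hyperplane `V₊(x_{d+1}) ≅ ℙ^d ↪ ℙ^{d+1}` misses the vertex `(0 : … : 0 : 1)`.
[folklore] -/
theorem skipMap_base_ne_vertex (y : (projectiveSpace d ℂ).left) :
    (ProjectiveSpace.skipMap (k := ℂ) (Fin.last (d + 1))).left.base y ≠ DeJong1996.vertex d ℂ := by
  intro h
  have hmem := ProjectiveSpace.range_skipMap_subset (k := ℂ) (Fin.last (d + 1)) ⟨y, rfl⟩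
  rw [h] at hmem
  have hX : (MvPolynomial.X (Fin.last (d + 1)) : MvPolynomial (Fin (d + 1 + 1)) ℂ) ∈
      (DeJong1996.vertex d ℂ).asHomogeneousIdeal := Set.singleton_subset_iff.1 hmem
  exact DeJong1996.X_last_notMem_vertexIdeal d ℂ hX

/-- The coordinate hyperplane `ℙ^d ≅ V₊(x_{d+1}) ↪ ℙ^{d+1} ∖ {vertex}`, as a morphism of schemes.
[folklore] -/
def hyperplaneToPunctured₀ :
    (projectiveSpace d ℂ).left ⟶ (DeJong1996.puncturedSpace d ℂ : Scheme) :=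
  IsOpenImmersion.lift (DeJong1996.puncturedSpace d ℂ).ι
    (ProjectiveSpace.skipMap (k := ℂ) (Fin.last (d + 1))).left (by
      rintro _ ⟨y, rfl⟩
      rw [Scheme.Opens.range_ι]
      exact (DeJong1996.mem_puncturedSpace_iff d ℂ _).2 (skipMap_base_ne_vertex d y))

/-- `hyperplaneToPunctured₀` followed by the inclusion is the coordinate embedding. [folklore] -/
@[reassoc]
theorem hyperplaneToPunctured₀_ι :
    hyperplaneToPunctured₀ d ≫ (DeJong1996.puncturedSpace d ℂ).ι =
      (ProjectiveSpace.skipMap (k := ℂ) (Fin.last (d + 1))).left :=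
  IsOpenImmersion.lift_fac _ _ _

/-- `ℙ^d ≅ V₊(x_{d+1}) ↪ ℙ^{d+1} ∖ {vertex}` is a closed immersion (a closed immersion into `ℙ^{d+1}`
factoring through the open). [folklore] -/
instance isClosedImmersion_hyperplaneToPunctured₀ : IsClosedImmersion (hyperplaneToPunctured₀ d) := by
  have h : IsClosedImmersion (ProjectiveSpace.skipMap (k := ℂ) (Fin.last (d + 1))).left := inferInstance
  haveI : IsClosedImmersion (hyperplaneToPunctured₀ d ≫ (DeJong1996.puncturedSpace d ℂ).ι) := by
    rw [hyperplaneToPunctured₀_ι]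
    exact h
  exact IsClosedImmersion.of_comp _ (DeJong1996.puncturedSpace d ℂ).ι

/-- **`ℙ^d ≅ V₊(x_{d+1}) → ℙ^{d+1} ∖ {vertex} → ℙ^d` is finite** (projection from a point not on a
closed subvariety is finite on it: proper and affine). [cite: GortzWedhorn2020, Thm. 13.89 (proof)] -/
instance isFinite_hyperplaneToPunctured₀_vertexProjection :
    IsFinite (hyperplaneToPunctured₀ d ≫ DeJong1996.vertexProjection d ℂ) := by
  have h1 : IsProper ((ProjectiveSpace.skipMap (k := ℂ) (Fin.last (d + 1))).left ≫
      (projectiveSpace (d + 1) ℂ).hom) := by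
    rw [Over.w]
    exact IsSmoothProjective.isProper_holds (isSmoothProjective_projectiveSpace' d)
  haveI : IsProper (hyperplaneToPunctured₀ d ≫ (DeJong1996.puncturedSpace d ℂ).ι ≫
      Segre.toSpec (Fin (d + 1 + 1)) ℂ) := by
    rw [hyperplaneToPunctured₀_ι_assoc]
    exact h1
  exact DeJong1996.isFinite_comp_vertexProjection d ℂ (hyperplaneToPunctured₀ d)

/-- The coordinate hyperplane `ℙ^d ≅ V₊(x_{d+1}) ↪ ℙ^{d+1} ∖ {vertex}` over `ℂ`. [folklore] -/
def hyperplaneToPunctured : projectiveSpace d ℂ ⟶ puncturedOver d :=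
  Over.homMk (hyperplaneToPunctured₀ d) (by
    change hyperplaneToPunctured₀ d ≫ (DeJong1996.puncturedSpace d ℂ).ι ≫ (projectiveSpace (d + 1) ℂ).hom = _
    rw [hyperplaneToPunctured₀_ι_assoc]
    exact Over.w (ProjectiveSpace.skipMap (k := ℂ) (Fin.last (d + 1))))

/-- **`pr(ℂ)_* : H_{2d}((ℙ^{d+1} ∖ vertex)(ℂ); ℂ) → H_{2d}(ℙ^d(ℂ); ℂ)` is one-to-one**, granted the
degree formula for the complex orientations: the source is a line, and the class of the coordinate
hyperplane `V₊(x_{d+1}) ≅ ℙ^d` (which misses the vertex) maps to `deg • [ℙ^d(ℂ)] ≠ 0`, the composite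
`ℙ^d → ℙ^{d+1} ∖ {vertex} → ℙ^d` being finite, hence of positive degree.
[cite: Fulton1998, Lemma 19.1.2] [cite: HatcherAT2002, §3.3 Lemma 3.27] -/
theorem injective_singularHomology_map_vertexProjectionOver
    (hA : complexOrientationFamily.HasDegreeFormula) :
    Function.Injective (singularHomology.map ℂ ℂ
      (AlgPoints.mapContinuous (L := ℂ) (vertexProjectionOver d)) (2 * d)) := by
  have hH : IsSmoothProjective d (projectiveSpace d ℂ) := isSmoothProjective_projectiveSpace' d
  haveI := irreducibleSpace_of_isSmoothProjective' hH
  haveI : IsIntegral (projectiveSpace d ℂ).left := Motives.IsSmoothProjective.isIntegral_holds hH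
  set F : projectiveSpace d ℂ ⟶ projectiveSpace d ℂ := hyperplaneToPunctured d ≫ vertexProjectionOver d
    with hFdef
  haveI : IsFinite F.left :=
    inferInstanceAs (IsFinite (hyperplaneToPunctured₀ d ≫ DeJong1996.vertexProjection d ℂ))
  set θ := genericPoint (projectiveSpace d ℂ).left with hθdef
  have hθ : height θ = d := height_eq_of_isGenericPoint hH (genericPoint_spec _)
  -- the composite is finite, so of positive degree
  have hk : 0 < AlgebraicCycle.mapCoeff F.left height height θ := by
    refine Nat.pos_of_ne_zero (mapCoeff_ne_zero_of_height_eq_of_isSmoothProjective hH hH F θ hθ ?_)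
    rw [Motives.height_base_eq_of_isFinite F.left θ, hθ]
  have hF := singularHomology_map_fundamentalClass_eq_smul hA hH hH F (genericPoint_spec _) hk
  rw [hFdef, singularHomology_map_comp_apply] at hF
  -- the witness class and its non-zero image
  set pr := singularHomology.map ℂ ℂ (AlgPoints.mapContinuous (L := ℂ) (vertexProjectionOver d)) (2 * d)
    with hprdef
  set w₀ := singularHomology.map ℂ ℂ (AlgPoints.mapContinuous (L := ℂ) (hyperplaneToPunctured d)) (2 * d)
    (complexOrientationFamily hH).fundamentalClass with hw₀def
  have hw₀ : pr w₀ ≠ 0 := by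
    rw [hF]
    exact smul_ne_zero (Nat.cast_ne_zero.2 hk.ne') (fundamentalClass_complexOrientationFamily_ne_zero hH)
  have hw₀' : w₀ ≠ 0 := fun h ↦ hw₀ (by rw [h, map_zero])
  -- the source is a line spanned by `w₀`
  have hline := finrank_singularHomology_puncturedOver d
  refine (injective_iff_map_eq_zero pr.hom).2 fun w hw ↦ ?_
  obtain ⟨a, rfl⟩ := (finrank_eq_one_iff_of_nonzero' w₀ hw₀').1 hline w
  have h : a • pr w₀ = 0 := by rw [← map_smul]; exact hw
  rcases smul_eq_zero.1 h with ha | ha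
  · rw [ha, zero_smul]
  · exact absurd ha hw₀

end HodgeTheory

end Literature.AlgebraicGeometry.HodgeTheory

end
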